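import Summits.HubbardSuperconductivity.HubbardSuperconductivity.Theses.YangSpectral

/-!
# Route `YangSpectral` — glue support `YangSpectralGlue` (stmt-HubbardSuperconductivity-8623)

`YangSpectralGlue : YangB1gRayleigh → YangDominantModeOverlap → YangSpectralThesis` (cruxes ⇒
repaired thesis). Take `(U, δ)` from `YangB1gRayleigh`; for a hypothesis sequence `(N, ψ)` get
`c > 0` and, eventually in even `L`, a unit `B₁g`-symmetric pair wavefunction `v₀` with Rayleigh
quotient `re ⟨v₀, ρ₂(ψ_L) v₀⟩ ≥ c · N_L`. The `B₁g` unit sphere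
`S_L = {w | star w ⬝ᵥ w = 1 ∧ IsDWaveSymmetric w}` is a closed (level set of the continuous
`w ↦ star w ⬝ᵥ w`, intersected with the equalisers of the continuous linear maps `w ↦ γ • w` and
`w ↦ χ_{B₁g}(γ) w`) and bounded (`|w i|² ≤ Σ_j |w j|² = 1`) subset of the finite-dimensional space
of pair wavefunctions, hence compact, and nonempty (`v₀ ∈ S_L`); the quotient
`w ↦ re ⟨w, ρ₂ w⟩` is continuous, so a maximiser `v⋆ ∈ S_L` exists (`IsCompact.exists_isMaxOn`)
with quotient `≥ c · N_L`. `YangDominantModeOverlap` at `(U, δ, c)` gives `c' > 0` and the overlap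
bound `c' L² ≤ |⟨v⋆, φ_d⟩|²` eventually; conclude with `min c c'` on the intersection of the two
eventual ranges. Sources: C. N. Yang, Rev. Mod. Phys. 34 (1962) 694, §4; the compactness step is
[folklore]. No new definitions.
-/

-- the mandated namespace `Summit.<Summit>.<Problem>.Theorems` repeats `HubbardSuperconductivity`
-- (single-problem summit, D-0017), which the `dupNamespace` linter flags on every declaration
set_option linter.dupNamespace false

namespace Summit.HubbardSuperconductivity.HubbardSuperconductivity.Theorems

open Matrix Filter
open Literature.MathematicalPhysics.QuantumLattice Literature.Probability.LatticeModels

section Sphere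

variable {ι : Type*} [Fintype ι]

/-- Every entry of a unit vector (`star w ⬝ᵥ w = 1`) has norm at most one:
`‖w i‖² = |w i|² ≤ Σ_j |w j|² = re (star w ⬝ᵥ w) = 1`. [folklore] -/
theorem norm_apply_le_one_of_star_dotProduct_eq_one {w : ι → ℂ} (hw : star w ⬝ᵥ w = 1)
    (i : ι) : ‖w i‖ ≤ 1 := by
  classical
  have hre : (star w ⬝ᵥ w).re = ∑ j, Complex.normSq (w j) := by
    simp only [dotProduct, Pi.star_apply, Complex.re_sum]
    refine Finset.sum_congr rfl fun j _ => ?_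
    rw [Complex.star_def, ← Complex.normSq_eq_conj_mul_self, Complex.ofReal_re]
  have hsum : ∑ j, Complex.normSq (w j) = 1 := by rw [← hre, hw, Complex.one_re]
  have hle : Complex.normSq (w i) ≤ 1 := by
    rw [← hsum]
    exact Finset.single_le_sum (fun j _ => Complex.normSq_nonneg (w j)) (Finset.mem_univ i)
  have h2 : ‖w i‖ ^ 2 ≤ 1 := by rw [Complex.sq_norm]; exact hle
  nlinarith [norm_nonneg (w i)]

/-- The unit sphere `{w | star w ⬝ᵥ w = 1}` of `ι → ℂ` is closed. [folklore] -/
theorem isClosed_setOf_star_dotProduct_eq_one :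
    IsClosed {w : ι → ℂ | star w ⬝ᵥ w = 1} :=
  isClosed_eq (continuous_id.star.dotProduct continuous_id) continuous_const

end Sphere

/-- The `B₁g` condition `IsDWaveSymmetric` cuts out a closed subset of the pair wavefunctions
(an intersection over `D₄` of equalisers of continuous maps). [folklore] -/
theorem isClosed_setOf_isDWaveSymmetric (L : ℕ) [NeZero L] :
    IsClosed {w : Orb (FermionTorus 2 L) × Orb (FermionTorus 2 L) → ℂ | IsDWaveSymmetric w} := by
  have hset : {w : Orb (FermionTorus 2 L) × Orb (FermionTorus 2 L) → ℂ | IsDWaveSymmetric w} =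
      ⋂ γ : DihedralGroup 4, {w | d4Act γ w = b1gChar γ • w} := by
    ext w
    simp [IsDWaveSymmetric, Set.mem_iInter]
  rw [hset]
  refine isClosed_iInter fun γ => isClosed_eq ?_ (continuous_const_smul (b1gChar γ))
  show Continuous fun w : Orb (FermionTorus 2 L) × Orb (FermionTorus 2 L) → ℂ =>
    fun p : Orb (FermionTorus 2 L) × Orb (FermionTorus 2 L) => w (d4Orb γ⁻¹ p.1, d4Orb γ⁻¹ p.2)
  exact continuous_pi fun p => continuous_apply _

/-- **The dominant `B₁g` pair mode exists.** On the `L × L` torus, for any state `ψ`, if the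
`B₁g` unit sphere is nonempty then the Rayleigh quotient `w ↦ re ⟨w, ρ₂(ψ) w⟩` attains its maximum
on it (compactness: closed and bounded in a finite-dimensional space). [folklore] -/
theorem exists_isMaxOn_b1gSphere (L : ℕ) [NeZero L] (ψ : Fock (Orb (FermionTorus 2 L)))
    {v₀ : Orb (FermionTorus 2 L) × Orb (FermionTorus 2 L) → ℂ} (hv₀ : star v₀ ⬝ᵥ v₀ = 1)
    (hv₀d : IsDWaveSymmetric v₀) :
    ∃ v : Orb (FermionTorus 2 L) × Orb (FermionTorus 2 L) → ℂ,
      star v ⬝ᵥ v = 1 ∧ IsDWaveSymmetric v ∧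
        ∀ w : Orb (FermionTorus 2 L) × Orb (FermionTorus 2 L) → ℂ, star w ⬝ᵥ w = 1 →
          IsDWaveSymmetric w →
            (star w ⬝ᵥ (twoParticleRDM ψ *ᵥ w)).re ≤ (star v ⬝ᵥ (twoParticleRDM ψ *ᵥ v)).re := by
  set S : Set (Orb (FermionTorus 2 L) × Orb (FermionTorus 2 L) → ℂ) :=
    {w | star w ⬝ᵥ w = 1} ∩ {w | IsDWaveSymmetric w} with hS
  have hclosed : IsClosed S :=
    isClosed_setOf_star_dotProduct_eq_one.inter (isClosed_setOf_isDWaveSymmetric L)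
  have hsub : S ⊆ Metric.closedBall 0 1 := by
    intro w hw
    rw [Metric.mem_closedBall, dist_zero_right, pi_norm_le_iff_of_nonneg zero_le_one]
    exact norm_apply_le_one_of_star_dotProduct_eq_one hw.1
  have hK : IsCompact S := (isCompact_closedBall _ _).of_isClosed_subset hclosed hsub
  have hf : Continuous fun w : Orb (FermionTorus 2 L) × Orb (FermionTorus 2 L) → ℂ =>
      (star w ⬝ᵥ (twoParticleRDM ψ *ᵥ w)).re :=
    Complex.continuous_re.comp
      (continuous_id.star.dotProduct (continuous_const.matrix_mulVec continuous_id))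
  obtain ⟨v, hvS, hvmax⟩ := hK.exists_isMaxOn ⟨v₀, hv₀, hv₀d⟩ hf.continuousOn
  refine ⟨v, hvS.1, hvS.2, fun w hw hwd => ?_⟩
  exact hvmax ⟨hw, hwd⟩

/-- **YangSpectralGlue** (item `stmt-HubbardSuperconductivity-8623`):
`YangB1gRayleigh → YangDominantModeOverlap → YangSpectralThesis`. [folklore] -/
theorem yangSpectralGlue_proof :
    Summit.HubbardSuperconductivity.HubbardSuperconductivity.Theses.YangSpectral.YangSpectralGlue := by
  unfold Summit.HubbardSuperconductivity.HubbardSuperconductivity.Theses.YangSpectral.YangSpectralGlue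
    Summit.HubbardSuperconductivity.HubbardSuperconductivity.Theses.YangSpectral.YangB1gRayleigh
    Summit.HubbardSuperconductivity.HubbardSuperconductivity.Theses.YangSpectral.YangDominantModeOverlap
    Summit.HubbardSuperconductivity.HubbardSuperconductivity.Theses.YangSpectral.YangSpectralThesis
  rintro ⟨U, hU, δ, hδ, hRay⟩ hOv
  refine ⟨U, hU, δ, hδ, fun N ψ hyp => ?_⟩
  obtain ⟨c, hc, hevR⟩ := hRay N ψ hyp
  obtain ⟨c', hc', hevO⟩ := hOv U δ hU hδ c hc N ψ hyp
  refine ⟨min c c', lt_min hc hc', (hevR.and hevO).mono fun L hL => ?_⟩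
  obtain ⟨hR, hO⟩ := hL
  intro _ hEv
  obtain ⟨v₀, hv₀, hv₀d, hv₀q⟩ := hR hEv
  obtain ⟨v, hv, hvd, hvmax⟩ := exists_isMaxOn_b1gSphere L (ψ L) hv₀ hv₀d
  have hvq : c * (N L : ℝ) ≤ (star v ⬝ᵥ (twoParticleRDM (ψ L) *ᵥ v)).re :=
    hv₀q.trans (hvmax v₀ hv₀ hv₀d)
  have hov := hO hEv v hv hvd hvmax hvq
  refine ⟨v, hv, hvd, hvmax, ?_, ?_⟩
  · exact le_trans (mul_le_mul_of_nonneg_right (min_le_left _ _) (Nat.cast_nonneg _)) hvq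
  · exact le_trans (mul_le_mul_of_nonneg_right (min_le_right _ _) (by positivity)) hov

end Summit.HubbardSuperconductivity.HubbardSuperconductivity.Theorems
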